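import Literature.MathematicalPhysics.KineticTheory.CollisionTubeMeanRung0
import Summits.AtomisticToContinuum.HydrodynamicLimit.Theorems.JParityClosureOddContactSymmetryTubeStatRegular
import HarnessLib

/-!
# The collision-tube side of S3 at rung 0 has the Enskog mean, conditionally on the contact theorem
# (`stub_tubeMeanRung0OfContact`, helper stub H5 of the crux line `even-rung-mean-variance`,
# `JParityClosure.EvenStressEnskog`, stmt-AtomisticToContinuum-13079)

RUNG 0 = constant profiles `(a, u, θ)`: the local Gibbs law `G_N` is the homogeneous canonical Gibbs law
of `N + 1` hard spheres of diameter `σ(N+1)^{-1/3}` on `𝕋³` with i.i.d. Maxwellian velocities.  For the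
time-integrated Gibbs mean of the fixed-time collision-tube functional
`A_t = tubeStat σ N χ g Ξ_L r r 1 κ t` (`Ξ_L = evenMarkTrunc k l L`) this file proves, ASSUMING the
canonical contact theorem in the crux's parametrisation (the antecedent: the rescaled near-contact pair
law is `Y(σ³) = (3/2π) f_ex′(σ³)` times Lebesgue measure on thin shells, uniformly, for `N` large):

  `|∫₀^τ E_{G_N} A_t dt − σ³ g(σ³) Y(σ³) Θ̄_L ∫₀^τ∫ χ| ≤ η` for `κ < κ₀(η)` and `N ≥ N₀(κ, η)`.

The whole static computation is the Literature chain `CollisionTubeGeometry` → `CollisionTubeMeasure` →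
`CollisionTubePairMean` → `CollisionTubeMeanRung0` (the fixed-time estimate
`abs_integral_tubeStat_sub_le`, with explicit constants) together with `HardSphereUniformDensityLLN` /
`CollisionTubeDensityWeight` (the density weight `g(σ³ρ_r(xᵢ))` freezes at `g(σ³)`); here only the
bookkeeping is done: `χ` is bounded on `[0, τ] × 𝕋³`, `g` on `[0, ∞)` (cutoff), the accuracy `ζ` of the
contact theorem, then `κ₀` (through the shell width `δ = 2Lκ ≤ δ₁(ζ)` and `2Lκ ≤ 1`), then the
continuity modulus of `g` at `σ³`, then `N₀` (contact theorem, uniform density LLN, the `O(1/N)` term),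
and the time integral over `[0, τ]` of a bound uniform in `t`.
-/

noncomputable section

open MeasureTheory Set Filter Topology
open scoped ENNReal InnerProductSpace BigOperators Pointwise

namespace Summit.AtomisticToContinuum.HydrodynamicLimit.Theorems.EvenStressEnskog

open Literature.Analysis.FluidPDE Literature.MathematicalPhysics.KineticTheory

/-- A continuous `g` vanishing on `[1, ∞)` is bounded on `[0, ∞)`. [folklore] -/
theorem exists_bound_of_cutoff {g : ℝ → ℝ} (hg : Continuous g) (hg0 : ∀ b, (1 : ℝ) ≤ b → g b = 0) :
    ∃ C : ℝ, 0 ≤ C ∧ ∀ y, 0 ≤ y → |g y| ≤ C := by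
  obtain ⟨C, hC⟩ := (isCompact_Icc (a := (0 : ℝ)) (b := 1)).exists_bound_of_continuousOn hg.continuousOn
  refine ⟨C, (norm_nonneg _).trans (hC 0 ⟨le_rfl, zero_le_one⟩), fun y hy => ?_⟩
  by_cases h1 : y ≤ 1
  · simpa only [Real.norm_eq_abs] using hC y ⟨hy, h1⟩
  · rw [hg0 y (le_of_not_ge h1), abs_zero]
    exact (norm_nonneg _).trans (hC 0 ⟨le_rfl, zero_le_one⟩)

/-- `K · (η / (4 (K + 1))) ≤ η / 4` for `K, η ≥ 0`. [folklore] -/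
theorem mul_div_four_le {K η : ℝ} (hK : 0 ≤ K) (hη : 0 ≤ η) : K * (η / (4 * (K + 1))) ≤ η / 4 := by
  rw [mul_div_assoc', div_le_div_iff₀ (by positivity) (by positivity)]
  nlinarith

/-- **H5 · the collision-tube side of S3 at rung 0 has the Enskog mean, conditionally on the canonical
contact theorem** (registered helper stub `stub_tubeMeanRung0OfContact` of the line
`even-rung-mean-variance`, verbatim, arrow form: antecedent = the contact theorem in the crux's
parametrisation). [folklore] -/
theorem stub_tubeMeanRung0OfContact : (∃ σ₁ : ℝ, 0 < σ₁ ∧ ∀ σ : ℝ, 0 < σ → σ < σ₁ → ∀ ζ : ℝ, 0 < ζ → ∃ δ₁ : ℝ, 0 < δ₁ ∧ ∀ δ : ℝ, 0 < δ → δ ≤ δ₁ → ∃ N₀ : ℕ, ∀ N : ℕ, N₀ ≤ N → ∀ (a θ : ℝ) (u : V3), 0 < a → 0 < θ → ∀ Φ : HardSphereFlow (Torus.geometry (Fin 3)) (hsDiameter σ N) (N + 1), ∀ i j : Fin (N + 1), i ≠ j → ∀ S : Set V3, MeasurableSet S → S ⊆ {q | 1 < ‖q‖ ∧ ‖q‖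 ≤ 1 + δ} → |(localGibbsLaw σ (fun _ => a) (fun _ => u) (fun _ => θ) N Φ).real {z | Torus.reprSym ((z i).1 - (z j).1) ∈ hsDiameter σ N • S} - contactValue (σ ^ 3) * hsDiameter σ N ^ 3 * (volume S).toReal| ≤ ζ * hsDiameter σ N ^ 3 * (volume S).toReal) → ∃ η₁ : ℝ, 0 < η₁ ∧ ∃ σ₀ : ℝ, 0 < σ₀ ∧ ∀ (σ a θ : ℝ) (u : V3) (τ : ℝ) (χ : ℝ × UnitAddTorus (Fin 3) → ℝ) (g : ℝ → ℝ) (k l : Fin 3) (L r : ℝ), 0 < σ → σ < σ₀ → σ ^ 3 < η₁ → 0 < a → 0 < θ → 0 < τ → Continuous χ → Continuous g → (∀ b, η₁ ≤ b → g b = 0) → 1 ≤ L → 0 < r → r < 1 / 4 → ∀ η : ℝ, 0 < η → ∃ κ₀ : ℝ, 0 < κ₀ ∧ ∀ κ : ℝ, 0 < κ → κ < κ₀ → ∀ Φ : (N : ℕ) → HardSphereFlow (Torus.geometry (Fin 3)) (hsDiameter σ N) (N + 1), ∃ N₀ : ℕ, ∀ N : ℕ, N₀ ≤ N → |(∫ t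 in Set.Icc (0 : ℝ) τ, ∫ z, tubeStat σ N χ g (evenMarkTrunc k l L) r r 1 κ t z ∂(localGibbsLaw σ (fun _ => a) (fun _ => u) (fun _ => θ) N (Φ N))) - σ ^ 3 * g (σ ^ 3) * contactValue (σ ^ 3) * (∫ p : V3 × V3, sphereMark (evenMarkTrunc k l L) p.1 p.2 * (localMaxwellian 1 θ u p.1 * localMaxwellian 1 θ u p.2)) * ∫ t in Set.Icc (0 : ℝ) τ, ∫ x : UnitAddTorus (Fin 3), χ (t, x)| ≤ η := by
  intro hContact
  obtain ⟨σ₁, hσ₁, HC⟩ := hContact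
  obtain ⟨σᵤ, hσᵤ, Hsmall⟩ := exists_smallDensity uniformProfile (m := 1) one_pos
  refine ⟨1, one_pos, min σ₁ σᵤ, lt_min hσ₁ hσᵤ, ?_⟩
  intro σ a θ u τ χ g k l L r hσ hσ0 _hσ31 ha hθ hτ hχ hg hg0 hL hr hr4 η hη
  have hσ1 : σ < σ₁ := lt_of_lt_of_le hσ0 (min_le_left _ _)
  have hσu : σ < σᵤ := lt_of_lt_of_le hσ0 (min_le_right _ _)
  have hsd : SmallDensity uniformProfile σ := (Hsmall σ hσ hσu).1
  have hσhalf : σ ≤ 1 / 2 := hsd.σ_lt_half.le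
  have hL0 : (0 : ℝ) ≤ L := zero_le_one.trans hL
  have hLpos : (0 : ℝ) < L := zero_lt_one.trans_le hL
  have hr2 : r < 1 / 2 := by linarith
  -- bounds for `χ` on `[0, τ] × 𝕋³` and for `g` on `[0, ∞)`
  obtain ⟨Cχ, hCχ⟩ := (isCompact_Icc.prod isCompact_univ).exists_bound_of_continuousOn
    (s := Set.Icc (0 : ℝ) τ ×ˢ (univ : Set (UnitAddTorus (Fin 3)))) hχ.continuousOn
  have hχb : ∀ t ∈ Set.Icc (0 : ℝ) τ, ∀ x : UnitAddTorus (Fin 3), |χ (t, x)| ≤ Cχ := fun t ht x => by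
    simpa only [Real.norm_eq_abs] using hCχ (t, x) ⟨ht, mem_univ _⟩
  have hCχ0 : 0 ≤ Cχ := (abs_nonneg _).trans (hχb 0 ⟨le_rfl, hτ.le⟩ 0)
  obtain ⟨Cg, hCg0, hCgb⟩ := exists_bound_of_cutoff hg hg0
  -- constants of the fixed-time estimate
  set σS : ℝ := (sphereMeasure : Measure (Metric.sphere (0 : V3) 1)).real univ with hσS
  have hσS0 : 0 ≤ σS := measureReal_nonneg
  set Θb : ℝ := ∫ p : V3 × V3, sphereMark (evenMarkTrunc k l L) p.1 p.2 *
    (localMaxwellian 1 θ u p.1 * localMaxwellian 1 θ u p.2) with hΘb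
  set Y : ℝ := contactValue (σ ^ 3) with hY
  -- (1) the accuracy of the contact theorem
  set K₁ : ℝ := τ * (σ ^ 3 * Cg * Cχ * (2 * L * (2 * L) * σS)) with hK₁
  have hK₁0 : 0 ≤ K₁ := by positivity
  set ζ : ℝ := η / (4 * (K₁ + 1)) with hζ
  have hζpos : 0 < ζ := by positivity
  have hζK : K₁ * ζ ≤ η / 4 := mul_div_four_le hK₁0 hη.le
  obtain ⟨δ₁, hδ₁, Hδ⟩ := HC σ hσ hσ1 ζ hζpos
  -- (2) the flight-time window
  refine ⟨min (δ₁ / (2 * L)) (1 / (2 * L)), lt_min (by positivity) (by positivity), ?_⟩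
  intro κ hκ hκ0 Φ
  have h2L : (0 : ℝ) < 2 * L := by positivity
  have hκδ : 2 * L * κ ≤ δ₁ := by
    have h := (lt_of_lt_of_le hκ0 (min_le_left _ _)).le
    rwa [le_div_iff₀ h2L, mul_comm] at h
  have hκ1 : 2 * L * κ ≤ 1 := by
    have h := (lt_of_lt_of_le hκ0 (min_le_right _ _)).le
    rwa [le_div_iff₀ h2L, mul_comm] at h
  have hδpos : 0 < 2 * L * κ := by positivity
  obtain ⟨N₁, HN₁⟩ := Hδ (2 * L * κ) hδpos hκδ
  -- (3) the density-weight replacement: accuracy `ζ'` and the continuity modulus of `g` at `σ³`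
  set K₂ : ℝ := τ * (κ⁻¹ * (2 * L * 125) * Cχ) with hK₂
  have hK₂0 : 0 ≤ K₂ := by positivity
  set ζ' : ℝ := η / (4 * (K₂ + 1)) with hζ'
  have hζ'pos : 0 < ζ' := by positivity
  have hζ'K : K₂ * ζ' ≤ η / 4 := mul_div_four_le hK₂0 hη.le
  obtain ⟨δg, hδg, Hg⟩ := Metric.continuous_iff.1 hg (σ ^ 3) ζ' hζ'pos
  have hσ3 : 0 < σ ^ 3 := by positivity
  set δ'' : ℝ := δg / σ ^ 3 with hδ''
  have hδ''pos : 0 < δ'' := by positivity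
  have hmod : ∀ y, 0 ≤ y → |y - 1| < δ'' → |g (σ ^ 3 * y) - g (σ ^ 3)| ≤ ζ' := by
    intro y _ hy
    have hd : dist (σ ^ 3 * y) (σ ^ 3) < δg := by
      rw [Real.dist_eq, show σ ^ 3 * y - σ ^ 3 = σ ^ 3 * (y - 1) by ring, abs_mul, abs_of_pos hσ3]
      calc σ ^ 3 * |y - 1| < σ ^ 3 * δ'' := mul_lt_mul_of_pos_left hy hσ3
        _ = δg := by rw [hδ'']; field_simp
    have := Hg _ hd
    rw [Real.dist_eq] at this
    exact this.le
  -- (4) the bad density event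
  set K₃ : ℝ := τ * (κ⁻¹ * (2 * L * 125) * Cχ * (2 * Cg)) with hK₃
  have hK₃0 : 0 ≤ K₃ := by positivity
  obtain ⟨N₂, HN₂⟩ := exists_posGibbs_sqDevEvent_le hsd ha hr hr2 hδ''pos (η := η / (4 * (K₃ + 1))) (by positivity)
  -- (5) the `O(1/N)` term
  set K₄ : ℝ := τ * (σ ^ 3 * Cg * Cχ * |Y| * |Θb|) with hK₄
  have hK₄0 : 0 ≤ K₄ := by positivity
  set N₃ : ℕ := Nat.ceil (4 * K₄ / η) with hN₃
  refine ⟨max N₁ (max N₂ N₃), fun N hN => ?_⟩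
  have hN1 : N₁ ≤ N := (le_max_left _ _).trans hN
  have hN2 : N₂ ≤ N := ((le_max_left _ _).trans (le_max_right _ _)).trans hN
  have hN3 : N₃ ≤ N := ((le_max_right _ _).trans (le_max_right _ _)).trans hN
  have hK₄N : K₄ / ((N : ℝ) + 1) ≤ η / 4 := by
    have hc : 4 * K₄ / η ≤ (N₃ : ℝ) := Nat.le_ceil _
    have hN3' : (N₃ : ℝ) ≤ N := by exact_mod_cast hN3
    rw [div_le_div_iff₀ (by positivity) (by positivity)]
    rw [div_le_iff₀ hη] at hc
    nlinarith
  -- the fixed-time estimate, uniformly in `t ∈ [0, τ]`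
  set G := localGibbsLaw σ (fun _ => a) (fun _ => u) (fun _ => θ) N (Φ N) with hG
  set PBad : ℝ := (posGibbsMeasure (fun _ : T3 => a) (hsDiameter σ N) (N + 1)).real (sqDevEvent (N + 1) δ'' r)
    with hPBad
  have hPBad0 : 0 ≤ PBad := measureReal_nonneg
  have hPBadle : PBad ≤ η / (4 * (K₃ + 1)) := HN₂ N hN2
  set B : ℝ := σ ^ 3 * Cg * Cχ * (2 * L * (2 * L) * σS) * ζ + κ⁻¹ * (2 * L * 125) * Cχ * (ζ' + 2 * Cg * PBad)
    + σ ^ 3 / (N + 1 : ℝ) * Cg * Cχ * |Y| * |Θb| with hB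
  have hC_N : ∀ i j : Fin (N + 1), i ≠ j → ∀ S : Set V3, MeasurableSet S →
      S ⊆ {q | 1 < ‖q‖ ∧ ‖q‖ ≤ 1 + 2 * L * κ} →
      |G.real {z | Torus.reprSym ((z i).1 - (z j).1) ∈ hsDiameter σ N • S}
        - contactValue (σ ^ 3) * hsDiameter σ N ^ 3 * (volume S).toReal|
        ≤ ζ * hsDiameter σ N ^ 3 * (volume S).toReal :=
    fun i j hij S hS hSδ => HN₁ N hN1 a θ u ha hθ (Φ N) i j hij S hS hSδ
  have hpt : ∀ t ∈ Set.Icc (0 : ℝ) τ,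
      |(∫ z, tubeStat σ N χ g (evenMarkTrunc k l L) r r 1 κ t z ∂G) -
        σ ^ 3 * g (σ ^ 3) * Y * Θb * ∫ x : UnitAddTorus (Fin 3), χ (t, x)| ≤ B := fun t ht =>
    abs_integral_tubeStat_sub_le (Φ N) hσ hσhalf ha hθ hχ (hχb t ht) hg hCgb k l hL0 hκ hζpos.le hζ'pos.le
      hδ''pos le_rfl hκ1 hr hmod hC_N
  -- `τ · B ≤ η`
  have hτB : B * τ ≤ η := by
    have e : B * τ = K₁ * ζ + K₂ * ζ' + K₃ * PBad + K₄ / ((N : ℝ) + 1) := by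
      rw [hB, hK₁, hK₂, hK₃, hK₄]; ring
    rw [e]
    have h3 : K₃ * PBad ≤ η / 4 := (mul_le_mul_of_nonneg_left hPBadle hK₃0).trans (mul_div_four_le hK₃0 hη.le)
    linarith
  -- time integration over `[0, τ]`
  haveI : IsProbabilityMeasure G := isProbabilityMeasure_localGibbsLaw continuous_const continuous_const
    continuous_const (fun _ => ha) (fun _ => hθ) hσhalf N (Φ N)
  have hfm : StronglyMeasurable fun t : ℝ => ∫ z, tubeStat σ N χ g (evenMarkTrunc k l L) r r 1 κ t z ∂G := by
    have hu : StronglyMeasurable (Function.uncurry fun (t : ℝ) (z : Config (N + 1) (Fin 3) T3) =>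
        tubeStat σ N χ g (evenMarkTrunc k l L) r r 1 κ t z) := by
      have h := (Summit.AtomisticToContinuum.HydrodynamicLimit.Theorems.measurable_tubeStat_uncurry σ N hχ hg
        (continuous_evenMarkTrunc k l L) r r 1 κ).stronglyMeasurable
      exact h
    exact hu.integral_prod_right'
  obtain ⟨BA, hBA⟩ := Summit.AtomisticToContinuum.HydrodynamicLimit.Theorems.exists_bound_tubeStat σ N hχ hg
    (exists_abs_evenMarkTrunc_le k l hL0) hr r zero_le_one hκ.le τ
  have hfb : ∀ t ∈ Set.Icc (0 : ℝ) τ, ‖∫ z, tubeStat σ N χ g (evenMarkTrunc k l L) r r 1 κ t z ∂G‖ ≤ BA := by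
    intro t ht
    have h := norm_integral_le_of_norm_le_const (μ := G) (C := BA)
      (f := fun z => tubeStat σ N χ g (evenMarkTrunc k l L) r r 1 κ t z)
      (ae_of_all _ fun z => by rw [Real.norm_eq_abs]; exact hBA t ht z)
    simpa only [probReal_univ, mul_one] using h
  have hfi : IntegrableOn (fun t : ℝ => ∫ z, tubeStat σ N χ g (evenMarkTrunc k l L) r r 1 κ t z ∂G)
      (Set.Icc (0 : ℝ) τ) volume :=
    Measure.integrableOn_of_bounded measure_Icc_lt_top.ne hfm.aestronglyMeasurable
      ((ae_restrict_mem measurableSet_Icc).mono hfb)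
  have hhm : StronglyMeasurable fun t : ℝ => ∫ x : UnitAddTorus (Fin 3), χ (t, x) := by
    have hu : StronglyMeasurable (Function.uncurry fun (t : ℝ) (x : UnitAddTorus (Fin 3)) => χ (t, x)) := by
      have h := hχ.measurable.stronglyMeasurable
      exact h
    exact hu.integral_prod_right'
  have hhb : ∀ t ∈ Set.Icc (0 : ℝ) τ, ‖∫ x : UnitAddTorus (Fin 3), χ (t, x)‖ ≤ Cχ := by
    intro t ht
    have h := norm_integral_le_of_norm_le_const (μ := (volume : Measure (UnitAddTorus (Fin 3)))) (C := Cχ)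
      (f := fun x => χ (t, x)) (ae_of_all _ fun x => by rw [Real.norm_eq_abs]; exact hχb t ht x)
    simpa only [probReal_univ, mul_one] using h
  have hhi : IntegrableOn (fun t : ℝ => ∫ x : UnitAddTorus (Fin 3), χ (t, x)) (Set.Icc (0 : ℝ) τ) volume :=
    Measure.integrableOn_of_bounded measure_Icc_lt_top.ne hhm.aestronglyMeasurable
      ((ae_restrict_mem measurableSet_Icc).mono hhb)
  rw [← integral_const_mul, ← integral_sub hfi (hhi.const_mul _)]
  have h := norm_setIntegral_le_of_norm_le_const (μ := (volume : Measure ℝ)) (s := Set.Icc (0 : ℝ) τ) (C := B)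
    (f := fun t => (∫ z, tubeStat σ N χ g (evenMarkTrunc k l L) r r 1 κ t z ∂G) -
      σ ^ 3 * g (σ ^ 3) * Y * Θb * ∫ x : UnitAddTorus (Fin 3), χ (t, x))
    measure_Icc_lt_top (fun t ht => by rw [Real.norm_eq_abs]; exact hpt t ht)
  rw [Real.norm_eq_abs, Real.volume_real_Icc_of_le hτ.le, sub_zero] at h
  exact h.trans hτB

end Summit.AtomisticToContinuum.HydrodynamicLimit.Theorems.EvenStressEnskog

end
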